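/-
Copyright (c) 2026 the pub-hodgecm-mathlib formalisation cell (harness21).  Prover seat hodgecm-mathlib-R90-C131-p02 (g0) (R90-TF S4 hand lent to L1
by CHAIR VALVE WORD W4), Track B «K2-LIT», hLiu418 = `stmt-HodgeConjecture-24832`; K1-a♮ line lead K2E5-p16 (g8) WORD #9 (1) «(Φ-S1) ROAD B, file (i)».
THEOREMS ONLY (no `def`, no instance, no notation, no named-fact hypothesis, no `sorry`); lane `--supports stmt-HodgeConjecture-24832 --as helper`.
-/
import Summits.HodgeConjecture.HodgeConjecture.Theorems.K2LiuHermTwoEtaRankOneLetter   -- ★ ED. 3a: `integrableOn_exp_mul_rpow_mul_rpow`, `integrableOn_jIntegrand`, majorant letters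
import HarnessLib

/-!
# Crux `HLiu418`, (Φ-S1) road B, file (i): the confluent letter family `J_{p,t}(α,β) = ∫₀^∞ e^{−pr}(r+2t)^{α−2}r^{β−2} dr` is CLOSED UNDER THE
# PARAMETER DERIVATIVES — `∂_p J(α,β) = −J(α,β+1)`, `∂_t J(α,β) = 2(α−2)·J(α−1,β)` (dominated differentiation in the real parameters)

Cell `hodgecm-mathlib`, crux item hLiu418 = `stmt-HodgeConjecture-24832` (helper lane, count-neutral).  Road B of (Φ-S1) (line lead K2E5-p16 (g8)
WORD #9): the twisted archimedean block of a general `K_w`-type is obtained from the scalar-type block ★ p863260 by differentiating in the POINT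
`h ∈ U(J)`; through ★ ED. 2 `etaTwo_rankOne_eq` the point enters the continued value only through the weight parameters `(p, q′)` of
`η₂ = (π/p)e^{−pt}(1/q′)^{α+β−2}Γ(α+β−2)·J_{p,t}(α,β)`.  This file supplies the first-order parameter calculus of the letter `J`: both
derivatives are again letters of the family (so every `(p,t)`-derivative of every order is a letter, holomorphic in `s` along the K1 lines by ★
`differentiableOn_jIntegral_line` and continued by ★ `exists_continuation_jIntegral_line`).
* §1 `rpow_le_rpow_add_rpow_base` (`y^a ≤ x^a + z^a` for `0 < x ≤ y ≤ z`), `ofReal_mul_cpow_sub_two` (`r·r^{β−2} = r^{β+1−2}`);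
* §2 **`hasDerivAt_jIntegral_param_p`** — `∂_p J(α, β) = −J(α, β+1)` (`p, t > 0`, `1 < re β`; ball `|p′−p| < p/2`, majorant `e^{−pr/2}(r+2t)^{re α−2}r^{re β−1}`);
* §3 **`hasDerivAt_jIntegral_param_t`** — `∂_t J(α, β) = 2(α−2)·J(α−1, β)` (ball `|t′−t| < t/2`, majorant `‖2(α−2)‖e^{−pr}((r+t)^{a}+(r+3t)^{a})r^{re β−2}`).

HONEST LABEL: analytic letters; closes no socket.  HC_CM is proved only modulo the 7 printed citations (2 remaining named inputs: hLiu418 =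
`stmt-HodgeConjecture-24832`, h413 = `stmt-HodgeConjecture-24833`) until rung 0 closes.  REL ≠ ★ ≠ BUILT.

## References
* [Shimura1982] G. Shimura, *Confluent hypergeometric functions on tube domains*, Math. Ann. 260 (1982), §3, §4 Thm. 4.2.
* [Shimura1997] G. Shimura, *Euler Products and Eisenstein Series*, CBMS 93 (1997), §16.4, §18.4–18.5.
-/

set_option autoImplicit false
set_option linter.dupNamespace false

noncomputable section

open Complex MeasureTheory Set Filter Real
open scoped Topology

namespace Summit.HodgeConjecture.HodgeConjecture.Cruxes.HLiu418.K2LiuHermTwoEtaShiftParamSmooth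

open Summit.HodgeConjecture.HodgeConjecture.Cruxes.HLiu418.K2LiuHermTwoEtaRankOneLetter

/-! ## §1 Two small letters -/

/-- `y^a ≤ x^a + z^a` for `0 < x ≤ y ≤ z` (use `z^a` if `0 ≤ a`, `x^a` if `a ≤ 0`). [folklore] -/
theorem rpow_le_rpow_add_rpow_base {x y z : ℝ} (hx : 0 < x) (hxy : x ≤ y) (hyz : y ≤ z) (a : ℝ) : y ^ a ≤ x ^ a + z ^ a := by
  have hy : 0 < y := lt_of_lt_of_le hx hxy
  have h1 : 0 ≤ x ^ a := Real.rpow_nonneg hx.le _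
  have h2 : 0 ≤ z ^ a := Real.rpow_nonneg (hy.le.trans hyz) _
  rcases le_or_gt 0 a with ha | ha
  · have : y ^ a ≤ z ^ a := Real.rpow_le_rpow hy.le hyz ha
    linarith
  · have : y ^ a ≤ x ^ a := Real.rpow_le_rpow_of_nonpos hx hxy ha.le
    linarith

/-- `r · r^{δ} = r^{δ+1}` in the shape `r^{(δ′+1)−2} ` used below: `(r:ℂ) * (r:ℂ)^(β−2) = (r:ℂ)^(β+1−2)` for `r > 0`. [folklore] -/
theorem ofReal_mul_cpow_sub_two {r : ℝ} (hr : 0 < r) (β : ℂ) : ((r : ℝ) : ℂ) * ((r : ℝ) : ℂ) ^ (β - 2) = ((r : ℝ) : ℂ) ^ (β + 1 - 2) := by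
  have hr0 : ((r : ℝ) : ℂ) ≠ 0 := by exact_mod_cast hr.ne'
  rw [show β + 1 - 2 = (β - 2) + 1 by ring, cpow_add _ _ hr0, cpow_one, mul_comm]

/-! ## §2 `∂_p J(α, β) = −J(α, β + 1)` -/

/-- **`∂_p J_{p,t}(α,β) = −J_{p,t}(α,β+1)`**: for `p, t > 0`, every `α` and `1 < re β`, the map
`p′ ↦ ∫₀^∞ e^{−p′r}(r+2t)^{α−2}r^{β−2} dr` has the (real-parameter, complex-valued) derivative `−∫₀^∞ e^{−pr}(r+2t)^{α−2}r^{β+1−2} dr` at `p`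
(differentiation under the integral sign on the ball `|p′ − p| < p/2`, majorant `e^{−(p/2)r}(r+2t)^{re α−2}r^{re β−1}` ★ `integrableOn_exp_mul_rpow_mul_rpow`).
[Shimura1982, §3] -/
theorem hasDerivAt_jIntegral_param_p {p t : ℝ} (hp : 0 < p) (ht : 0 < t) (α : ℂ) {β : ℂ} (hβ : 1 < β.re) :
    HasDerivAt (fun p' : ℝ => ∫ r in Ioi (0 : ℝ), cexp (-((p' * r : ℝ) : ℂ)) * ((((r + 2 * t : ℝ)) : ℂ) ^ (α - 2) * ((r : ℝ) : ℂ) ^ (β - 2)))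
      (-∫ r in Ioi (0 : ℝ), cexp (-((p * r : ℝ) : ℂ)) * ((((r + 2 * t : ℝ)) : ℂ) ^ (α - 2) * ((r : ℝ) : ℂ) ^ (β + 1 - 2))) p := by
  set F : ℝ → ℝ → ℂ := fun p' r => cexp (-((p' * r : ℝ) : ℂ)) * ((((r + 2 * t : ℝ)) : ℂ) ^ (α - 2) * ((r : ℝ) : ℂ) ^ (β - 2)) with hF
  set F' : ℝ → ℝ → ℂ := fun p' r => -(cexp (-((p' * r : ℝ) : ℂ)) * ((((r + 2 * t : ℝ)) : ℂ) ^ (α - 2) * ((r : ℝ) : ℂ) ^ (β + 1 - 2))) with hF'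
  set bound : ℝ → ℝ := fun r => Real.exp (-(p / 2 * r)) * ((r + 2 * t) ^ (α - 2).re * r ^ (β + 1 - 2).re) with hbound
  have hβ2 : -1 < (β - 2).re := by simp only [sub_re, re_ofNat]; linarith
  have hβ1 : -1 < (β + 1 - 2).re := by simp only [sub_re, add_re, one_re, re_ofNat]; linarith
  -- continuity in `r` on `(0, ∞)` (measurability), for every `p′`
  have hcontF : ∀ p' : ℝ, ContinuousOn (F p') (Ioi 0) := by
    intro p' r hr
    have hr' : (0 : ℝ) < r := hr
    simp only [hF]
    refine ContinuousAt.continuousWithinAt ?_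
    refine (by fun_prop : ContinuousAt (fun r : ℝ => cexp (-((p' * r : ℝ) : ℂ))) r).mul (ContinuousAt.mul ?_ ?_)
    · exact ((Complex.continuous_ofReal.comp (by fun_prop : Continuous fun r : ℝ => r + 2 * t)).continuousAt).cpow
        continuousAt_const (Or.inl (by rw [Function.comp_apply, Complex.ofReal_re]; positivity))
    · exact (Complex.continuous_ofReal.continuousAt).cpow continuousAt_const (Or.inl (by rw [Complex.ofReal_re]; exact hr'))
  have hcontF' : ContinuousOn (F' p) (Ioi 0) := by
    intro r hr
    have hr' : (0 : ℝ) < r := hr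
    simp only [hF']
    refine ContinuousAt.continuousWithinAt (ContinuousAt.neg ?_)
    refine (by fun_prop : ContinuousAt (fun r : ℝ => cexp (-((p * r : ℝ) : ℂ))) r).mul (ContinuousAt.mul ?_ ?_)
    · exact ((Complex.continuous_ofReal.comp (by fun_prop : Continuous fun r : ℝ => r + 2 * t)).continuousAt).cpow
        continuousAt_const (Or.inl (by rw [Function.comp_apply, Complex.ofReal_re]; positivity))
    · exact (Complex.continuous_ofReal.continuousAt).cpow continuousAt_const (Or.inl (by rw [Complex.ofReal_re]; exact hr'))
  -- integrability at `p`, and of the bound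
  have hint : Integrable (F p) (volume.restrict (Ioi 0)) := integrableOn_jIntegrand hp ht (α - 2) hβ2
  have hbound_int : Integrable bound (volume.restrict (Ioi 0)) :=
    integrableOn_exp_mul_rpow_mul_rpow (half_pos hp) ht (α - 2).re hβ1
  -- pointwise derivative in `p′`
  have hderiv : ∀ r ∈ Ioi (0 : ℝ), ∀ p' : ℝ, HasDerivAt (fun p' => F p' r) (F' p' r) p' := by
    intro r hr p'
    have hr' : (0 : ℝ) < r := hr
    have he : HasDerivAt (fun z : ℂ => cexp (-(z * (r : ℂ)))) (cexp (-((p' : ℂ) * (r : ℂ))) * (-(r : ℂ))) (p' : ℂ) := by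
      have h1 : HasDerivAt (fun z : ℂ => -(z * (r : ℂ))) (-(r : ℂ)) (p' : ℂ) := by
        have h := ((hasDerivAt_id (p' : ℂ)).mul_const (r : ℂ)).neg
        simp only [id_eq, one_mul] at h
        exact h
      exact h1.cexp
    have he' : HasDerivAt (fun p' : ℝ => cexp (-((p' * r : ℝ) : ℂ))) (cexp (-((p' * r : ℝ) : ℂ)) * (-(r : ℂ))) p' := by
      have h := he.comp_ofReal
      have e1 : (fun y : ℝ => cexp (-((y : ℂ) * (r : ℂ)))) = fun p' : ℝ => cexp (-((p' * r : ℝ) : ℂ)) := by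
        funext y; push_cast; ring_nf
      rw [e1] at h
      have e2 : cexp (-((p' : ℂ) * (r : ℂ))) = cexp (-((p' * r : ℝ) : ℂ)) := by push_cast; ring_nf
      rw [e2] at h
      exact h
    have h := he'.mul_const ((((r + 2 * t : ℝ)) : ℂ) ^ (α - 2) * ((r : ℝ) : ℂ) ^ (β - 2))
    simp only [hF, hF']
    refine h.congr_deriv ?_
    rw [← ofReal_mul_cpow_sub_two hr' β]
    ring
  -- domination on the ball `|p′ − p| < p/2`
  have hball : ∀ r ∈ Ioi (0 : ℝ), ∀ p' ∈ Metric.ball p (p / 2), ‖F' p' r‖ ≤ bound r := by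
    intro r hr p' hp'
    have hr' : (0 : ℝ) < r := hr
    have hp'2 : p / 2 < p' := by
      have hd : |p' - p| < p / 2 := by rwa [Metric.mem_ball, Real.dist_eq] at hp'
      linarith [(abs_lt.1 hd).1]
    simp only [hF', hbound, norm_neg]
    rw [norm_jIntegrand ht (α - 2) (β + 1 - 2) hr']
    have hmono : Real.exp (-(p' * r)) ≤ Real.exp (-(p / 2 * r)) := Real.exp_le_exp.2 (by nlinarith)
    exact mul_le_mul_of_nonneg_right hmono (mul_nonneg (Real.rpow_nonneg (by positivity) _) (Real.rpow_nonneg hr'.le _))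
  -- dominated differentiation
  have key := hasDerivAt_integral_of_dominated_loc_of_deriv_le (μ := volume.restrict (Ioi 0)) (F := F) (F' := F') (x₀ := p)
    (bound := bound) (s := Metric.ball p (p / 2)) (Metric.ball_mem_nhds p (half_pos hp))
    (Eventually.of_forall fun p' => (hcontF p').aestronglyMeasurable measurableSet_Ioi) hint
    (hcontF'.aestronglyMeasurable measurableSet_Ioi)
    ((ae_restrict_iff' measurableSet_Ioi).2 (Eventually.of_forall fun r hr p' hp' => hball r hr p' hp')) hbound_int
    ((ae_restrict_iff' measurableSet_Ioi).2 (Eventually.of_forall fun r hr p' _ => hderiv r hr p'))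
  have h2 := key.2
  simp only [hF'] at h2
  rw [integral_neg] at h2
  exact h2

/-! ## §3 `∂_t J(α, β) = 2(α − 2)·J(α − 1, β)` -/

/-- **`∂_t J_{p,t}(α,β) = 2(α−2)·J_{p,t}(α−1,β)`**: for `p, t > 0`, every `α` and `1 < re β`, the map
`t′ ↦ ∫₀^∞ e^{−pr}(r+2t′)^{α−2}r^{β−2} dr` has derivative `2(α−2)·∫₀^∞ e^{−pr}(r+2t)^{α−1−2}r^{β−2} dr` at `t` (differentiation under the
integral sign on the ball `|t′ − t| < t/2`, majorant `‖2(α−2)‖·e^{−pr}((r+t)^{a}+(r+3t)^{a})r^{re β−2}`, `a = re α − 3`). [Shimura1982, §3] -/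
theorem hasDerivAt_jIntegral_param_t {p t : ℝ} (hp : 0 < p) (ht : 0 < t) (α : ℂ) {β : ℂ} (hβ : 1 < β.re) :
    HasDerivAt (fun t' : ℝ => ∫ r in Ioi (0 : ℝ), cexp (-((p * r : ℝ) : ℂ)) * ((((r + 2 * t' : ℝ)) : ℂ) ^ (α - 2) * ((r : ℝ) : ℂ) ^ (β - 2)))
      (2 * (α - 2) * ∫ r in Ioi (0 : ℝ), cexp (-((p * r : ℝ) : ℂ)) * ((((r + 2 * t : ℝ)) : ℂ) ^ (α - 1 - 2) * ((r : ℝ) : ℂ) ^ (β - 2))) t := by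
  set F : ℝ → ℝ → ℂ := fun t' r => cexp (-((p * r : ℝ) : ℂ)) * ((((r + 2 * t' : ℝ)) : ℂ) ^ (α - 2) * ((r : ℝ) : ℂ) ^ (β - 2)) with hF
  set F' : ℝ → ℝ → ℂ := fun t' r => 2 * (α - 2) * (cexp (-((p * r : ℝ) : ℂ)) * ((((r + 2 * t' : ℝ)) : ℂ) ^ (α - 1 - 2) * ((r : ℝ) : ℂ) ^ (β - 2)))
    with hF'
  set a : ℝ := (α - 1 - 2).re with ha
  set bound : ℝ → ℝ := fun r => ‖(2 : ℂ) * (α - 2)‖ * (Real.exp (-(p * r)) * ((r + 2 * (t / 2)) ^ a * r ^ (β - 2).re) +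
    Real.exp (-(p * r)) * ((r + 2 * (3 * t / 2)) ^ a * r ^ (β - 2).re)) with hbound
  have hβ2 : -1 < (β - 2).re := by simp only [sub_re, re_ofNat]; linarith
  -- continuity in `r` on `(0, ∞)` for every `t′ > 0`… we only need it near `t`; for `t′` with `0 < t′`:
  have hcontF : ∀ t' : ℝ, 0 < t' → ContinuousOn (F t') (Ioi 0) := by
    intro t' ht' r hr
    have hr' : (0 : ℝ) < r := hr
    simp only [hF]
    refine ContinuousAt.continuousWithinAt ?_
    refine (by fun_prop : ContinuousAt (fun r : ℝ => cexp (-((p * r : ℝ) : ℂ))) r).mul (ContinuousAt.mul ?_ ?_)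
    · exact ((Complex.continuous_ofReal.comp (by fun_prop : Continuous fun r : ℝ => r + 2 * t')).continuousAt).cpow
        continuousAt_const (Or.inl (by rw [Function.comp_apply, Complex.ofReal_re]; positivity))
    · exact (Complex.continuous_ofReal.continuousAt).cpow continuousAt_const (Or.inl (by rw [Complex.ofReal_re]; exact hr'))
  have hcontF' : ContinuousOn (F' t) (Ioi 0) := by
    intro r hr
    have h1 := (hcontF t ht)  -- reuse the shape at exponent `α − 1`
    have hr' : (0 : ℝ) < r := hr
    simp only [hF']
    refine ContinuousAt.continuousWithinAt ((continuousAt_const).mul ?_)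
    refine (by fun_prop : ContinuousAt (fun r : ℝ => cexp (-((p * r : ℝ) : ℂ))) r).mul (ContinuousAt.mul ?_ ?_)
    · exact ((Complex.continuous_ofReal.comp (by fun_prop : Continuous fun r : ℝ => r + 2 * t)).continuousAt).cpow
        continuousAt_const (Or.inl (by rw [Function.comp_apply, Complex.ofReal_re]; positivity))
    · exact (Complex.continuous_ofReal.continuousAt).cpow continuousAt_const (Or.inl (by rw [Complex.ofReal_re]; exact hr'))
  -- measurability for `t′` in the ball (all such `t′` are positive)
  have hmeas : ∀ᶠ t' in 𝓝 t, AEStronglyMeasurable (F t') (volume.restrict (Ioi 0)) := by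
    filter_upwards [Metric.ball_mem_nhds t (half_pos ht)] with t' ht'
    have ht'pos : 0 < t' := by
      have hd : |t' - t| < t / 2 := by rwa [Metric.mem_ball, Real.dist_eq] at ht'
      linarith [(abs_lt.1 hd).1]
    exact (hcontF t' ht'pos).aestronglyMeasurable measurableSet_Ioi
  -- integrability at `t`, and of the bound
  have hint : Integrable (F t) (volume.restrict (Ioi 0)) := integrableOn_jIntegrand hp ht (α - 2) hβ2
  have hbound_int : Integrable bound (volume.restrict (Ioi 0)) := by
    have h1 := integrableOn_exp_mul_rpow_mul_rpow hp (half_pos ht) a hβ2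
    have h2 := integrableOn_exp_mul_rpow_mul_rpow hp (by positivity : 0 < 3 * t / 2) a hβ2
    exact ((h1.add h2).const_mul _)
  -- pointwise derivative in `t′` (for `t′ > 0`)
  have hderiv : ∀ r ∈ Ioi (0 : ℝ), ∀ t' ∈ Metric.ball t (t / 2), HasDerivAt (fun t' => F t' r) (F' t' r) t' := by
    intro r hr t' ht'
    have hr' : (0 : ℝ) < r := hr
    have ht'pos : 0 < t' := by
      have hd : |t' - t| < t / 2 := by rwa [Metric.mem_ball, Real.dist_eq] at ht'
      linarith [(abs_lt.1 hd).1]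
    have hslit : ((r : ℂ) + 2 * (t' : ℂ)) ∈ slitPlane := by
      rw [show ((r : ℂ) + 2 * (t' : ℂ)) = ((r + 2 * t' : ℝ) : ℂ) by push_cast; ring]
      exact Complex.ofReal_mem_slitPlane.2 (by positivity)
    have hlin : HasDerivAt (fun z : ℂ => (r : ℂ) + 2 * z) 2 (t' : ℂ) := by
      have h := ((hasDerivAt_id (t' : ℂ)).const_mul (2 : ℂ)).const_add (r : ℂ)
      simp only [id_eq, mul_one] at h
      exact h
    have hpw : HasDerivAt (fun z : ℂ => ((r : ℂ) + 2 * z) ^ (α - 2)) ((α - 2) * ((r : ℂ) + 2 * (t' : ℂ)) ^ (α - 2 - 1) * 2) (t' : ℂ) :=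
      hlin.cpow_const hslit
    have hpw' : HasDerivAt (fun t' : ℝ => (((r + 2 * t' : ℝ)) : ℂ) ^ (α - 2)) ((α - 2) * (((r + 2 * t' : ℝ)) : ℂ) ^ (α - 1 - 2) * 2) t' := by
      have h := hpw.comp_ofReal
      have e1 : (fun y : ℝ => ((r : ℂ) + 2 * (y : ℂ)) ^ (α - 2)) = fun t' : ℝ => (((r + 2 * t' : ℝ)) : ℂ) ^ (α - 2) := by
        funext y; push_cast; ring_nf
      rw [e1, show ((r : ℂ) + 2 * (t' : ℂ)) = ((r + 2 * t' : ℝ) : ℂ) by push_cast; ring, show α - 2 - 1 = α - 1 - 2 by ring] at h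
      exact h
    have h := (hpw'.mul_const (((r : ℝ) : ℂ) ^ (β - 2))).const_mul (cexp (-((p * r : ℝ) : ℂ)))
    simp only [hF, hF']
    refine h.congr_deriv ?_
    ring
  -- domination on the ball `|t′ − t| < t/2`
  have hball : ∀ r ∈ Ioi (0 : ℝ), ∀ t' ∈ Metric.ball t (t / 2), ‖F' t' r‖ ≤ bound r := by
    intro r hr t' ht'
    have hr' : (0 : ℝ) < r := hr
    have hd : |t' - t| < t / 2 := by rwa [Metric.mem_ball, Real.dist_eq] at ht'
    have hlt := abs_lt.1 hd
    have ht'pos : 0 < t' := by linarith [hlt.1]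
    simp only [hF', hbound]
    rw [norm_mul, norm_jIntegrand ht'pos (α - 1 - 2) (β - 2) hr']
    refine mul_le_mul_of_nonneg_left ?_ (norm_nonneg _)
    have he : 0 < Real.exp (-(p * r)) := Real.exp_pos _
    have hrb : 0 ≤ r ^ (β - 2).re := Real.rpow_nonneg hr'.le _
    have hbase : (r + 2 * t') ^ a ≤ (r + 2 * (t / 2)) ^ a + (r + 2 * (3 * t / 2)) ^ a :=
      rpow_le_rpow_add_rpow_base (by positivity) (by linarith [hlt.1]) (by linarith [hlt.2]) a
    calc Real.exp (-(p * r)) * ((r + 2 * t') ^ a * r ^ (β - 2).re)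
        ≤ Real.exp (-(p * r)) * (((r + 2 * (t / 2)) ^ a + (r + 2 * (3 * t / 2)) ^ a) * r ^ (β - 2).re) :=
          mul_le_mul_of_nonneg_left (mul_le_mul_of_nonneg_right hbase hrb) he.le
      _ = Real.exp (-(p * r)) * ((r + 2 * (t / 2)) ^ a * r ^ (β - 2).re) + Real.exp (-(p * r)) * ((r + 2 * (3 * t / 2)) ^ a * r ^ (β - 2).re) := by
          ring
  -- dominated differentiation
  have key := hasDerivAt_integral_of_dominated_loc_of_deriv_le (μ := volume.restrict (Ioi 0)) (F := F) (F' := F') (x₀ := t)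
    (bound := bound) (s := Metric.ball t (t / 2)) (Metric.ball_mem_nhds t (half_pos ht)) hmeas hint
    (hcontF'.aestronglyMeasurable measurableSet_Ioi)
    ((ae_restrict_iff' measurableSet_Ioi).2 (Eventually.of_forall fun r hr t' ht' => hball r hr t' ht')) hbound_int
    ((ae_restrict_iff' measurableSet_Ioi).2 (Eventually.of_forall fun r hr t' ht' => hderiv r hr t' ht'))
  have h2 := key.2
  simp only [hF'] at h2
  rw [integral_const_mul] at h2
  exact h2

end Summit.HodgeConjecture.HodgeConjecture.Cruxes.HLiu418.K2LiuHermTwoEtaShiftParamSmooth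

end
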